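import Literature.Probability.LatticeModels.StarLattice
import Literature.Probability.LatticeModels.ThermodynamicLimit
import HarnessLib

/-!
# `★`-connected sets and the boundary lemma B.82 of Friedli–Velenik

Topic `Literature/Probability/LatticeModels`. For the `★`-graph `ℤ^{d★}` of `StarLattice.lean`:
`★`-connected sets of lattice points (`StarConn`, chains of `★`-adjacent points inside the set,
with the dictionary to walks), the `★`-ball `B∞(x,1)` as an order interval, the exterior and
interior `★`-boundaries `∂^ex A`, `∂^in A` of a finite set, and

> **Lemma B.82 (Friedli–Velenik 2017, App. B.15).** If `A ⊂ ℤ^d` is finite, `★`-connected, and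
> has a `★`-connected complement, then `∂^ex_★ A` and `∂^in_★ A` are `★`-connected,

deduced, as in the book, from the abstract boundary lemma B.83
(`CycleSpace.exists_generator_crossing_both`) applied to the generating family of `★`-triangles
(Lemma B.81, `generatesCycles_zdStar`): if a boundary were split into two classes with no
`★`-edge between them, the boundary `★`-edges would split accordingly, a single triangle would
meet both classes, and two distinct vertices of a triangle are `★`-adjacent. Both boundaries are
handled at once by classifying a boundary edge `ab` (`a ∈ A`, `b ∉ A`) through a chosen endpoint
`pick a b ∈ {a, b}` (`starConn_boundary_pick`).

Everything is proved; no named facts.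

## References

* S. Friedli, Y. Velenik, *Statistical Mechanics of Lattice Systems*, CUP 2017, App. B.15,
  Lemmas B.81–B.83; §7.2.6, Lemma 7.19. [FriedliVelenik2017]
* Á. Timár, Proc. AMS 141 (2013) 475–480 (the cycle-space method). [Timar2013]
-/

noncomputable section

open Finset SimpleGraph Relation
open Literature.Combinatorics.SimpleGraph.CycleSpace

namespace Literature.Probability.LatticeModels

variable {d : ℕ}

/-! ### `★`-connected sets -/

/-- `★`-adjacency inside the set `S`. [cite: FriedliVelenik2017, §7.2.6 (connectedness for d_∞)] -/
def starRel (S : Set (Site d)) (a b : Site d) : Prop := (zdStar d).Adj a b ∧ a ∈ S ∧ b ∈ S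

/-- `starRel S` is symmetric. [folklore] -/
theorem starRel_symm {S : Set (Site d)} {a b : Site d} (h : starRel S a b) : starRel S b a :=
  ⟨h.1.symm, h.2.2, h.2.1⟩

/-- `starRel` is monotone in the set. [folklore] -/
theorem starRel_mono {S T : Set (Site d)} (h : S ⊆ T) {a b : Site d} (hab : starRel S a b) : starRel T a b :=
  ⟨hab.1, h hab.2.1, h hab.2.2⟩

/-- A set of lattice points is **`★`-connected** if any two of its points are joined by a chain of
`★`-adjacent points of the set (Friedli–Velenik's "connected" for the distance `d_∞`).
[cite: FriedliVelenik2017, §7.2.6 (definition of connectedness)] -/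
def StarConn (S : Set (Site d)) : Prop := ∀ x ∈ S, ∀ y ∈ S, ReflTransGen (starRel S) x y

/-- Chains inside a smaller set are chains inside a larger one. [folklore] -/
theorem reflTransGen_starRel_mono {S T : Set (Site d)} (h : S ⊆ T) {x y : Site d}
    (hxy : ReflTransGen (starRel S) x y) : ReflTransGen (starRel T) x y :=
  by
  induction hxy with
  | refl => exact ReflTransGen.refl
  | tail _ hbc ih => exact ih.tail (starRel_mono h hbc)

/-- The end of a chain inside `S` from a point of `S` lies in `S`. [folklore] -/
theorem mem_of_reflTransGen_starRel {S : Set (Site d)} {x y : Site d} (h : ReflTransGen (starRel S) x y)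
    (hx : x ∈ S) : y ∈ S := by
  induction h with
  | refl => exact hx
  | tail _ hbc _ => exact hbc.2.2

/-- Chains can be reversed. [folklore] -/
theorem reflTransGen_starRel_symm {S : Set (Site d)} {x y : Site d} (h : ReflTransGen (starRel S) x y) :
    ReflTransGen (starRel S) y x := by
  induction h with
  | refl => exact ReflTransGen.refl
  | tail _ hbc ih => exact ReflTransGen.head (starRel_symm hbc) ih

/-- A chain inside `U` from a point of a set `C ⊆ U` closed under `U`-steps stays inside `C`.
[folklore] -/
theorem reflTransGen_starRel_restrict {U C : Set (Site d)} (hC : ∀ a ∈ C, ∀ b, starRel U a b → b ∈ C)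
    {x y : Site d} (hx : x ∈ C) (h : ReflTransGen (starRel U) x y) : ReflTransGen (starRel C) x y := by
  induction h with
  | refl => exact ReflTransGen.refl
  | tail hab hbc ih =>
    have hb : _ ∈ C := mem_of_reflTransGen_starRel ih hx
    exact ih.tail ⟨hbc.1, hb, hC _ hb _ hbc⟩

/-- From a chain inside `S` to a `★`-walk with support in `S`. [folklore] -/
theorem exists_walk_of_reflTransGen {S : Set (Site d)} {x y : Site d} (h : ReflTransGen (starRel S) x y)
    (hx : x ∈ S) : ∃ p : (zdStar d).Walk x y, ∀ w ∈ p.support, w ∈ S := by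
  induction h with
  | refl => exact ⟨Walk.nil, fun w hw => by rw [Walk.support_nil, List.mem_singleton] at hw; rw [hw]; exact hx⟩
  | tail _ hbc ih =>
    obtain ⟨p, hp⟩ := ih
    refine ⟨p.concat hbc.1, fun w hw => ?_⟩
    rw [Walk.support_concat, List.mem_append, List.mem_singleton] at hw
    rcases hw with hw | rfl
    · exact hp w hw
    · exact hbc.2.2

/-- From a `★`-walk with support in `S` to a chain inside `S`. [folklore] -/
theorem reflTransGen_of_walk {S : Set (Site d)} {x y : Site d} (p : (zdStar d).Walk x y)
    (hp : ∀ w ∈ p.support, w ∈ S) : ReflTransGen (starRel S) x y := by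
  induction p with
  | nil => exact ReflTransGen.refl
  | cons h p ih =>
    rename_i u v w
    have hu : u ∈ S := hp u (Walk.start_mem_support _)
    have hv : v ∈ S := hp v (by rw [Walk.support_cons]; exact List.mem_cons_of_mem _ (Walk.start_mem_support p))
    exact ReflTransGen.head ⟨h, hu, hv⟩ (ih fun w hw => hp w (by rw [Walk.support_cons]; exact List.mem_cons_of_mem _ hw))

/-! ### The `★`-ball -/

/-- The `★`-ball `B∞(x, 1) = {y : ‖x - y‖_∞ ≤ 1}` (with `3^d` points), as the order interval
`[x - 1, x + 1]` of `ℤ^d`. [cite: FriedliVelenik2017, §7.2.1 (i + B(1))] -/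
def starBall (x : Site d) : Finset (Site d) := Finset.Icc (x - 1) (x + 1)

/-- Membership in the `★`-ball is `‖x - y‖_∞ ≤ 1`. [cite: FriedliVelenik2017, §7.2.1] -/
theorem mem_starBall {x y : Site d} : y ∈ starBall x ↔ supDist x y ≤ 1 := by
  rw [starBall, Finset.mem_Icc, supDist_le_iff, Pi.le_def, Pi.le_def]
  simp only [Pi.sub_apply, Pi.add_apply, Pi.one_apply]
  constructor
  · rintro ⟨h1, h2⟩ i
    have := h1 i; have := h2 i; omega
  · intro h
    exact ⟨fun i => by have := h i; omega, fun i => by have := h i; omega⟩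

/-- The centre belongs to its ball. [folklore] -/
theorem mem_starBall_self (x : Site d) : x ∈ starBall x := mem_starBall.2 (by simp)

/-- `★`-adjacency in terms of the ball. [cite: FriedliVelenik2017, App. B.15] -/
theorem adj_iff_mem_starBall {x y : Site d} : (zdStar d).Adj x y ↔ y ∈ starBall x ∧ x ≠ y := by
  rw [zdStar_adj, mem_starBall]; tauto

/-- The ball relation is symmetric. [folklore] -/
theorem mem_starBall_comm {x y : Site d} : y ∈ starBall x ↔ x ∈ starBall y := by
  rw [mem_starBall, mem_starBall, supDist_comm]

/-- `|B∞(x,1)| = 3^d`. [cite: FriedliVelenik2017, §7.2.1] -/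
theorem card_starBall (x : Site d) : #(starBall x) = 3 ^ d := by
  rw [starBall, Pi.card_Icc]
  simp only [Pi.sub_apply, Pi.one_apply, Pi.add_apply, Int.card_Icc]
  rw [Finset.prod_congr rfl fun i _ => show (x i + 1 + 1 - (x i - 1)).toNat = 3 by omega, Finset.prod_const,
    Finset.card_univ, Fintype.card_fin]

/-! ### Exterior and interior `★`-boundaries -/

/-- The exterior `★`-boundary `∂^ex A = {y ∉ A : y ★-adjacent to A}` of a finite set.
[cite: FriedliVelenik2017, §7.1 eq. (7.3) and App. B.15 (∂^ex_★)] -/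
def exBoundary (A : Finset (Site d)) : Finset (Site d) := A.biUnion starBall \ A

/-- Membership in `∂^ex A`. [cite: FriedliVelenik2017, eq. (7.3)] -/
theorem mem_exBoundary {A : Finset (Site d)} {y : Site d} :
    y ∈ exBoundary A ↔ y ∉ A ∧ ∃ x ∈ A, (zdStar d).Adj x y := by
  rw [exBoundary, mem_sdiff, mem_biUnion]
  constructor
  · rintro ⟨⟨x, hx, hy⟩, hyA⟩
    exact ⟨hyA, x, hx, adj_iff_mem_starBall.2 ⟨hy, fun h => hyA (h ▸ hx)⟩⟩
  · rintro ⟨hyA, x, hx, hadj⟩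
    exact ⟨⟨x, hx, (adj_iff_mem_starBall.1 hadj).1⟩, hyA⟩

/-- The interior `★`-boundary `∂^in A = {x ∈ A : x ★-adjacent to Aᶜ}` of a finite set.
[cite: FriedliVelenik2017, §7.1 eq. (7.3) and App. B.15 (∂^in_★)] -/
def inBoundary (A : Finset (Site d)) : Finset (Site d) := A.filter fun x => ∃ y ∈ starBall x, y ∉ A

/-- Membership in `∂^in A`. [cite: FriedliVelenik2017, eq. (7.3)] -/
theorem mem_inBoundary {A : Finset (Site d)} {x : Site d} :
    x ∈ inBoundary A ↔ x ∈ A ∧ ∃ y, y ∉ A ∧ (zdStar d).Adj x y := by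
  rw [inBoundary, mem_filter]
  refine and_congr_right fun hx => ⟨?_, ?_⟩
  · rintro ⟨y, hy, hyA⟩
    exact ⟨y, hyA, adj_iff_mem_starBall.2 ⟨hy, fun h => hyA (h ▸ hx)⟩⟩
  · rintro ⟨y, hyA, hadj⟩
    exact ⟨y, (adj_iff_mem_starBall.1 hadj).1, hyA⟩

/-! ### Lemma B.82 -/

/-- The vertices of an explicit triangle. [folklore] -/
theorem eq_or_eq_or_eq_of_mem_triangle {p q r v : Site d} {e : Sym2 (Site d)}
    (he : e ∈ ({s(p, q), s(q, r), s(p, r)} : Finset (Sym2 (Site d)))) (hv : v ∈ e) : v = p ∨ v = q ∨ v = r := by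
  rcases mem_triangle_iff.1 he with rfl | rfl | rfl <;> rcases Sym2.mem_iff.1 hv with rfl | rfl <;> simp

/-- Two distinct vertices of a `★`-triangle are `★`-adjacent. [cite: FriedliVelenik2017, App. B.15] -/
theorem adj_of_mem_starTriangle {T : Finset (Sym2 (Site d))} (hT : T ∈ starTriangles d) {v v' : Site d}
    {e e' : Sym2 (Site d)} (he : e ∈ T) (hv : v ∈ e) (he' : e' ∈ T) (hv' : v' ∈ e') (hne : v ≠ v') :
    (zdStar d).Adj v v' := by
  obtain ⟨p, q, r, hpq, hqr, hpr, rfl⟩ := hT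
  have h1 := eq_or_eq_or_eq_of_mem_triangle he hv
  have h2 := eq_or_eq_or_eq_of_mem_triangle he' hv'
  rcases h1 with rfl | rfl | rfl <;> rcases h2 with rfl | rfl | rfl <;>
    first | exact absurd rfl hne | exact hpq | exact hqr | exact hpr | exact hpq.symm | exact hqr.symm | exact hpr.symm

/-- **The boundary lemma, two-in-one form.** Let `A` be finite, `★`-connected with `★`-connected
complement, and choose for every pair an endpoint `pick a b ∈ {a, b}`. Then the set of points
`pick a b` over the boundary `★`-edges `ab` (`a ∈ A`, `b ∉ A`) is `★`-connected. (For
`pick a b = b` this is `∂^ex A`, for `pick a b = a` it is `∂^in A`.) Proof (Friedli–Velenik,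
App. B.15): were it split into a class `P₁` and the rest with no `★`-edge between them, the boundary
edges would split into two non-empty classes by their picked endpoint; by Lemma B.83 (with the
`★`-triangles as generators, Lemma B.81) one triangle contains edges of both classes, and their two
picked endpoints are distinct vertices of that triangle, hence `★`-adjacent — a contradiction.
[cite: FriedliVelenik2017, App. B.15, Lemma B.82 (proof via Lemma B.83)] -/
theorem starConn_boundary_pick {A : Finset (Site d)} (hA : StarConn (A : Set (Site d)))
    (hAc : StarConn (A : Set (Site d))ᶜ) (pick : Site d → Site d → Site d)
    (hpick : ∀ a b, pick a b = a ∨ pick a b = b) :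
    StarConn {z | ∃ a b, a ∈ A ∧ b ∉ A ∧ (zdStar d).Adj a b ∧ pick a b = z} := by
  classical
  set P : Set (Site d) := {z | ∃ a b, a ∈ A ∧ b ∉ A ∧ (zdStar d).Adj a b ∧ pick a b = z} with hP
  intro x hx y hy
  by_contra hxy
  obtain ⟨ax, bx, hax, hbx, hadjx, hpx⟩ := hx
  obtain ⟨ay, cy, hay, hcy, hadjy, hpy⟩ := hy
  -- the boundary `★`-edges
  set E : Finset (Sym2 (Site d)) := A.biUnion fun a => ((starBall a).filter (· ∉ A)).image fun b => s(a, b) with hE'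
  have hE : ∀ e, e ∈ E ↔ ∃ a b, a ∈ A ∧ b ∉ A ∧ (zdStar d).Adj a b ∧ e = s(a, b) := by
    intro e
    simp only [hE', mem_biUnion, mem_image, mem_filter]
    constructor
    · rintro ⟨a, ha, b, ⟨hb, hbA⟩, rfl⟩
      exact ⟨a, b, ha, hbA, adj_iff_mem_starBall.2 ⟨hb, fun h => hbA (h ▸ ha)⟩, rfl⟩
    · rintro ⟨a, b, ha, hbA, hadj, rfl⟩
      exact ⟨a, ha, b, ⟨(adj_iff_mem_starBall.1 hadj).1, hbA⟩, rfl⟩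
  -- a boundary edge has a unique orientation from `A` to `Aᶜ`
  have horient : ∀ a b a' b', a ∈ A → b ∉ A → a' ∈ A → b' ∉ A → s(a, b) = s(a', b') → a = a' ∧ b = b' := by
    intro a b a' b' ha hb ha' hb' h
    rcases Sym2.eq_iff.1 h with ⟨h1, h2⟩ | ⟨h1, h2⟩
    · exact ⟨h1, h2⟩
    · exact absurd (h1 ▸ ha) hb'
  -- the class of `x` and the induced splitting of the boundary edges
  set P₁ : Set (Site d) := {z | ReflTransGen (starRel P) x z} with hP₁
  set E₁ : Finset (Sym2 (Site d)) := E.filter fun e => ∃ a b, a ∈ A ∧ b ∉ A ∧ e = s(a, b) ∧ pick a b ∈ P₁ with hE₁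
  set E₂ : Finset (Sym2 (Site d)) := E.filter fun e => ∃ a b, a ∈ A ∧ b ∉ A ∧ e = s(a, b) ∧ pick a b ∉ P₁ with hE₂
  -- connectivity in walk form
  have hA' : ∀ a ∈ A, ∀ a' ∈ A, ∃ p : (zdStar d).Walk a a', ∀ w ∈ p.support, w ∈ A := by
    intro a ha a' ha'
    obtain ⟨p, hp⟩ := exists_walk_of_reflTransGen (hA a (mem_coe.2 ha) a' (mem_coe.2 ha')) (mem_coe.2 ha)
    exact ⟨p, fun w hw => mem_coe.1 (hp w hw)⟩
  have hAc' : ∀ b ∉ A, ∀ b' ∉ A, ∃ p : (zdStar d).Walk b b', ∀ w ∈ p.support, w ∉ A := by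
    intro b hb b' hb'
    have hb1 : b ∈ (A : Set (Site d))ᶜ := fun h => hb (mem_coe.1 h)
    have hb1' : b' ∈ (A : Set (Site d))ᶜ := fun h => hb' (mem_coe.1 h)
    obtain ⟨p, hp⟩ := exists_walk_of_reflTransGen (hAc b hb1 b' hb1') hb1
    exact ⟨p, fun w hw h => hp w hw (mem_coe.2 h)⟩
  -- the splitting is a partition of the crossing `★`-edges
  have hEpart : ∀ e, e ∈ E₁ ∨ e ∈ E₂ ↔ e ∈ (zdStar d).edgeSet ∧ Crosses A e := by
    intro e
    constructor
    · rintro (h | h)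
      · obtain ⟨a, b, ha, hb, hadj, rfl⟩ := (hE e).1 (mem_filter.1 h).1
        exact ⟨(mem_edgeSet _).2 hadj, (crosses_mk A a b).2 (Or.inl ⟨ha, hb⟩)⟩
      · obtain ⟨a, b, ha, hb, hadj, rfl⟩ := (hE e).1 (mem_filter.1 h).1
        exact ⟨(mem_edgeSet _).2 hadj, (crosses_mk A a b).2 (Or.inl ⟨ha, hb⟩)⟩
    · rintro ⟨hedge, hcr⟩
      obtain ⟨a, b, ha, hb, hadj, rfl⟩ : ∃ a b, a ∈ A ∧ b ∉ A ∧ (zdStar d).Adj a b ∧ e = s(a, b) := by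
        revert hedge hcr
        induction e using Sym2.ind with
        | h u v =>
          intro hedge hcr
          rw [crosses_mk] at hcr
          rw [mem_edgeSet] at hedge
          rcases hcr with ⟨hu, hv⟩ | ⟨hu, hv⟩
          · exact ⟨u, v, hu, hv, hedge, rfl⟩
          · exact ⟨v, u, hv, hu, hedge.symm, Sym2.eq_swap⟩
      have heE : s(a, b) ∈ E := (hE _).2 ⟨a, b, ha, hb, hadj, rfl⟩
      by_cases hp : pick a b ∈ P₁
      · exact Or.inl (mem_filter.2 ⟨heE, a, b, ha, hb, rfl, hp⟩)
      · exact Or.inr (mem_filter.2 ⟨heE, a, b, ha, hb, rfl, hp⟩)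
  have hdisj : Disjoint E₁ E₂ := by
    rw [Finset.disjoint_left]
    intro e h1 h2
    obtain ⟨-, a, b, ha, hb, rfl, hp⟩ := mem_filter.1 h1
    obtain ⟨-, a', b', ha', hb', heq, hp'⟩ := mem_filter.1 h2
    obtain ⟨rfl, rfl⟩ := horient a b a' b' ha hb ha' hb' heq
    exact hp' hp
  have h1ne : E₁.Nonempty :=
    ⟨s(ax, bx), mem_filter.2 ⟨(hE _).2 ⟨ax, bx, hax, hbx, hadjx, rfl⟩, ax, bx, hax, hbx, rfl, by
      rw [hpx]; exact ReflTransGen.refl⟩⟩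
  have h2ne : E₂.Nonempty :=
    ⟨s(ay, cy), mem_filter.2 ⟨(hE _).2 ⟨ay, cy, hay, hcy, hadjy, rfl⟩, ay, cy, hay, hcy, rfl, by
      rw [hpy]; exact hxy⟩⟩
  -- Lemma B.83: one triangle meets both classes
  obtain ⟨T, hT, ⟨e₁, he₁T, he₁⟩, ⟨e₂, he₂T, he₂⟩⟩ := exists_generator_crossing_both (generatesCycles_zdStar d)
    (fun C hC => isEvenEdgeSet_of_mem_starTriangles hC) (fun C hC e he => mem_edgeSet_of_mem_starTriangles hC he)
    hA' hAc' hEpart h1ne h2ne hdisj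
  obtain ⟨he₁E, a₁, b₁, ha₁, hb₁, rfl, hp₁⟩ := mem_filter.1 he₁
  obtain ⟨he₂E, a₂, b₂, ha₂, hb₂, rfl, hp₂⟩ := mem_filter.1 he₂
  have hadj₁ : (zdStar d).Adj a₁ b₁ := by
    obtain ⟨a, b, ha, hb, hadj, heq⟩ := (hE _).1 he₁E
    obtain ⟨rfl, rfl⟩ := horient _ _ _ _ ha₁ hb₁ ha hb heq
    exact hadj
  have hadj₂ : (zdStar d).Adj a₂ b₂ := by
    obtain ⟨a, b, ha, hb, hadj, heq⟩ := (hE _).1 he₂E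
    obtain ⟨rfl, rfl⟩ := horient _ _ _ _ ha₂ hb₂ ha hb heq
    exact hadj
  -- the two picked endpoints are distinct vertices of `T`, hence adjacent
  have hv₁ : pick a₁ b₁ ∈ s(a₁, b₁) := by
    rcases hpick a₁ b₁ with h | h <;> rw [h]
    · exact Sym2.mem_mk_left _ _
    · exact Sym2.mem_mk_right _ _
  have hv₂ : pick a₂ b₂ ∈ s(a₂, b₂) := by
    rcases hpick a₂ b₂ with h | h <;> rw [h]
    · exact Sym2.mem_mk_left _ _
    · exact Sym2.mem_mk_right _ _
  have hne : pick a₁ b₁ ≠ pick a₂ b₂ := fun h => hp₂ (h ▸ hp₁)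
  have hadj12 := adj_of_mem_starTriangle hT he₁T hv₁ he₂T hv₂ hne
  have hP1 : pick a₁ b₁ ∈ P := ⟨a₁, b₁, ha₁, hb₁, hadj₁, rfl⟩
  have hP2 : pick a₂ b₂ ∈ P := ⟨a₂, b₂, ha₂, hb₂, hadj₂, rfl⟩
  exact hp₂ (ReflTransGen.tail hp₁ ⟨hadj12, hP1, hP2⟩)

/-- **Lemma B.82, exterior boundary** (Friedli–Velenik 2017): if the finite set `A` and its
complement are `★`-connected then `∂^ex_★ A` is `★`-connected.
[cite: FriedliVelenik2017, App. B.15, Lemma B.82] -/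
theorem starConn_exBoundary {A : Finset (Site d)} (hA : StarConn (A : Set (Site d)))
    (hAc : StarConn (A : Set (Site d))ᶜ) : StarConn ((exBoundary A : Finset (Site d)) : Set (Site d)) := by
  have h := starConn_boundary_pick hA hAc (fun _ b => b) (fun _ _ => Or.inr rfl)
  have hset : ((exBoundary A : Finset (Site d)) : Set (Site d)) =
      {z | ∃ a b, a ∈ A ∧ b ∉ A ∧ (zdStar d).Adj a b ∧ b = z} := by
    ext z
    simp only [mem_coe, mem_exBoundary, Set.mem_setOf_eq]
    constructor
    · rintro ⟨hz, a, ha, hadj⟩; exact ⟨a, z, ha, hz, hadj, rfl⟩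
    · rintro ⟨a, b, ha, hb, hadj, rfl⟩; exact ⟨hb, a, ha, hadj⟩
  rw [hset]; exact h

/-- **Lemma B.82, interior boundary** (Friedli–Velenik 2017): if the finite set `A` and its
complement are `★`-connected then `∂^in_★ A` is `★`-connected.
[cite: FriedliVelenik2017, App. B.15, Lemma B.82] -/
theorem starConn_inBoundary {A : Finset (Site d)} (hA : StarConn (A : Set (Site d)))
    (hAc : StarConn (A : Set (Site d))ᶜ) : StarConn ((inBoundary A : Finset (Site d)) : Set (Site d)) := by
  have h := starConn_boundary_pick hA hAc (fun a _ => a) (fun _ _ => Or.inl rfl)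
  have hset : ((inBoundary A : Finset (Site d)) : Set (Site d)) =
      {z | ∃ a b, a ∈ A ∧ b ∉ A ∧ (zdStar d).Adj a b ∧ a = z} := by
    ext z
    simp only [mem_coe, mem_inBoundary, Set.mem_setOf_eq]
    constructor
    · rintro ⟨hz, b, hb, hadj⟩; exact ⟨z, b, hz, hb, hadj, rfl⟩
    · rintro ⟨a, b, ha, hb, hadj, rfl⟩; exact ⟨ha, b, hb, hadj⟩
  rw [hset]; exact h

end Literature.Probability.LatticeModels

end
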